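import Mathlib.Analysis.Convex.Function
import Mathlib.Analysis.SpecialFunctions.Sqrt
import Mathlib.Data.Real.Basic
import Mathlib.Topology.Order.OrderClosed
import Mathlib.Topology.ContinuousOn
import Mathlib.Topology.Instances.Real.Lemmas
import Mathlib.Tactic.Linarith
import Mathlib.Tactic.FieldSimp
import HarnessLib

/-!
# FunctionalMining — towards `BurkConcave` (4): adding the endpoints of the interval (jump DOWN allowed)

search for candidate a priori estimates; no regularity claim.  Cell `pub-nsfunc`, prove seat gen 7.  Fourth set of bricks for the
DISCHARGE of the typed hypothesis `Laminate.BurkConcave` (Burkholder 1991, LNM 1464, §8): the domain of the line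
`t ↦ (x + th, y + tk)` is the closed interval `{‖x + th‖ ≤ 1} = [t₀, t₁]`, and at its endpoints the point `x + th` lies on
the unit SPHERE, where Burkholder's `u_λ` takes the values `0` (`‖y + tk‖ < λ`) or `1` (`‖y + tk‖ ≥ λ`) and is continuous
except at the corner `‖y + tk‖ = λ`, where it never exceeds its limit from inside (there the inside piece is `D₂`'s
`(1 − q)/((λ − Z)² + 1 − q) → 1`, because `1 − q` vanishes LINEARLY and `(λ − Z)²` quadratically at a non-degenerate endpoint —
a Taylor comparison, not mere continuity: referee F40.1; this assembly step is MOOT since 2026-08-20T19:30Z: the whole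
concavity clause is the tree theorem `Literature.Probability.Process.burkholderU_concaveOn` (lit seat, p233232), bridged to
`Laminate.BurkConcave` by `Laminate.burkConcave_holds` (p233689); these bricks remain as an independent, unfinished route).
The elementary fact recorded here:
a function concave on the OPEN interval extends to a concave function on the closed one as soon as each endpoint value does
not exceed the lower limit from inside (`∀ ε > 0`, eventually `f b ≤ f y + ε`) — continuity is the special case of equality,
a jump down is allowed, a jump up is not.  CONTENT: `Burk.endpoint_right_aux`, `Burk.endpoint_left_aux` (the two-point
estimates), `Burk.concaveOn_Ioc_of_Ioo`, `Burk.concaveOn_Icc_of_Ioc`, `Burk.concaveOn_Icc_of_Ioo_of_liminf`.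
HONEST SIZE: first-year analysis; nothing about `u_λ` itself is proved here.  Nothing about Navier–Stokes.
-/

noncomputable section

namespace Summit.NavierStokesRegularity.FunctionalMining

namespace Burk

open Set Filter Topology

/-- **Right-endpoint two-point estimate.** If `f` is concave on `s`, `x ∈ s`, `(x, b) ⊆ s`, and `f b` does not exceed the
lower limit of `f` at `b⁻` (`∀ ε > 0`, eventually `f b ≤ f y + ε`), then `μ f(x) + ν f(b) ≤ f(μx + νb)` for `μ, ν > 0`,
`μ + ν = 1`. [ours; elementary] -/
theorem endpoint_right_aux {f : ℝ → ℝ} {s : Set ℝ} {b x μ ν : ℝ} (hf : ConcaveOn ℝ s f) (hxs : x ∈ s) (hxb : x < b)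
    (hseg : Ioo x b ⊆ s) (hb : ∀ ε : ℝ, 0 < ε → ∀ᶠ y in 𝓝[<] b, f b ≤ f y + ε)
    (hμ : 0 < μ) (hν : 0 < ν) (hμν : μ + ν = 1) :
    μ * f x + ν * f b ≤ f (μ * x + ν * b) := by
  obtain ⟨z, hz⟩ : ∃ z, z = μ * x + ν * b := ⟨_, rfl⟩
  have hμ' : μ = 1 - ν := by linarith
  have hxz : x < z := by rw [hz, hμ']; nlinarith
  have hzb : z < b := by rw [hz, hμ']; nlinarith
  have hzs : z ∈ s := hseg ⟨hxz, hzb⟩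
  rw [← hz]
  refine le_of_forall_pos_le_add fun ε hε => ?_
  -- along y → b⁻: z = μ' x + ν' y with μ' = (y - z)/(y - x), ν' = (z - x)/(y - x)
  have key : ∀ᶠ y in 𝓝[<] b, (y - z) / (y - x) * f x + (z - x) / (y - x) * (f b - ε) ≤ f z := by
    have h1 : ∀ᶠ y in 𝓝[<] b, z < y := (eventually_gt_nhds hzb).filter_mono nhdsWithin_le_nhds
    have h2 : ∀ᶠ y in 𝓝[<] b, y < b := eventually_mem_nhdsWithin
    filter_upwards [h1, h2, hb ε hε] with y hzy hyb hfy
    have hxy : 0 < y - x := by linarith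
    have hys : y ∈ s := hseg ⟨by linarith, hyb⟩
    have hm : 0 ≤ (y - z) / (y - x) := div_nonneg (by linarith) hxy.le
    have hn : 0 ≤ (z - x) / (y - x) := div_nonneg (by linarith) hxy.le
    have hmn : (y - z) / (y - x) + (z - x) / (y - x) = 1 := by
      field_simp; ring
    have hc := hf.2 hxs hys hm hn hmn
    simp only [smul_eq_mul] at hc
    have e : (y - z) / (y - x) * x + (z - x) / (y - x) * y = z := by
      field_simp; ring
    rw [e] at hc
    have : (z - x) / (y - x) * (f b - ε) ≤ (z - x) / (y - x) * f y :=
      mul_le_mul_of_nonneg_left (by linarith) hn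
    linarith
  -- the left-hand side is continuous in y at b
  have hbx : b - x ≠ 0 := by linarith
  have lim : Tendsto (fun y => (y - z) / (y - x) * f x + (z - x) / (y - x) * (f b - ε)) (𝓝[<] b)
      (𝓝 ((b - z) / (b - x) * f x + (z - x) / (b - x) * (f b - ε))) := by
    have h1 : Tendsto (fun y : ℝ => y - z) (𝓝 b) (𝓝 (b - z)) := tendsto_id.sub tendsto_const_nhds
    have h2 : Tendsto (fun y : ℝ => y - x) (𝓝 b) (𝓝 (b - x)) := tendsto_id.sub tendsto_const_nhds
    exact (((h1.div h2 hbx).mul_const _).add ((tendsto_const_nhds.div h2 hbx).mul_const _)).mono_left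
      nhdsWithin_le_nhds
  have hle := le_of_tendsto lim key
  have e1 : (b - z) / (b - x) = μ := by rw [hz, hμ']; field_simp; ring
  have e2 : (z - x) / (b - x) = ν := by rw [hz, hμ']; field_simp; ring
  rw [e1, e2] at hle
  have hν1 : ν ≤ 1 := by linarith
  nlinarith

/-- **Left-endpoint two-point estimate** (mirror image of `endpoint_right_aux`): if `f` is concave on `s`, `y ∈ s`,
`(a, y) ⊆ s`, and `f a` does not exceed the lower limit of `f` at `a⁺`, then `μ f(a) + ν f(y) ≤ f(μa + νy)` for
`μ, ν > 0`, `μ + ν = 1`. [ours; elementary] -/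
theorem endpoint_left_aux {f : ℝ → ℝ} {s : Set ℝ} {a y μ ν : ℝ} (hf : ConcaveOn ℝ s f) (hys : y ∈ s) (hay : a < y)
    (hseg : Ioo a y ⊆ s) (ha : ∀ ε : ℝ, 0 < ε → ∀ᶠ w in 𝓝[>] a, f a ≤ f w + ε)
    (hμ : 0 < μ) (hν : 0 < ν) (hμν : μ + ν = 1) :
    μ * f a + ν * f y ≤ f (μ * a + ν * y) := by
  obtain ⟨z, hz⟩ : ∃ z, z = μ * a + ν * y := ⟨_, rfl⟩
  have hμ' : μ = 1 - ν := by linarith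
  have haz : a < z := by rw [hz, hμ']; nlinarith
  have hzy : z < y := by rw [hz, hμ']; nlinarith
  have hzs : z ∈ s := hseg ⟨haz, hzy⟩
  rw [← hz]
  refine le_of_forall_pos_le_add fun ε hε => ?_
  -- along w → a⁺: z = μ' w + ν' y with μ' = (y - z)/(y - w), ν' = (z - w)/(y - w)
  have key : ∀ᶠ w in 𝓝[>] a, (y - z) / (y - w) * (f a - ε) + (z - w) / (y - w) * f y ≤ f z := by
    have h1 : ∀ᶠ w in 𝓝[>] a, w < z := (eventually_lt_nhds haz).filter_mono nhdsWithin_le_nhds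
    have h2 : ∀ᶠ w in 𝓝[>] a, a < w := eventually_mem_nhdsWithin
    filter_upwards [h1, h2, ha ε hε] with w hwz haw hfw
    have hwy : 0 < y - w := by linarith
    have hws : w ∈ s := hseg ⟨haw, by linarith⟩
    have hm : 0 ≤ (y - z) / (y - w) := div_nonneg (by linarith) hwy.le
    have hn : 0 ≤ (z - w) / (y - w) := div_nonneg (by linarith) hwy.le
    have hmn : (y - z) / (y - w) + (z - w) / (y - w) = 1 := by
      field_simp; ring
    have hc := hf.2 hws hys hm hn hmn
    simp only [smul_eq_mul] at hc
    have e : (y - z) / (y - w) * w + (z - w) / (y - w) * y = z := by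
      field_simp; ring
    rw [e] at hc
    have : (y - z) / (y - w) * (f a - ε) ≤ (y - z) / (y - w) * f w :=
      mul_le_mul_of_nonneg_left (by linarith) hm
    linarith
  have hya : y - a ≠ 0 := by linarith
  have lim : Tendsto (fun w => (y - z) / (y - w) * (f a - ε) + (z - w) / (y - w) * f y) (𝓝[>] a)
      (𝓝 ((y - z) / (y - a) * (f a - ε) + (z - a) / (y - a) * f y)) := by
    have h1 : Tendsto (fun w : ℝ => z - w) (𝓝 a) (𝓝 (z - a)) := tendsto_const_nhds.sub tendsto_id
    have h2 : Tendsto (fun w : ℝ => y - w) (𝓝 a) (𝓝 (y - a)) := tendsto_const_nhds.sub tendsto_id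
    exact (((tendsto_const_nhds.div h2 hya).mul_const _).add ((h1.div h2 hya).mul_const _)).mono_left
      nhdsWithin_le_nhds
  have hle := le_of_tendsto lim key
  have e1 : (y - z) / (y - a) = μ := by rw [hz, hμ']; field_simp; ring
  have e2 : (z - a) / (y - a) = ν := by rw [hz, hμ']; field_simp; ring
  rw [e1, e2] at hle
  have hμ1 : μ ≤ 1 := by linarith
  nlinarith

/-- **Adding the right endpoint.** If `f` is concave on `(a, b)` and `f b` does not exceed the lower limit of `f` at
`b⁻`, then `f` is concave on `(a, b]`. [ours; elementary] -/
theorem concaveOn_Ioc_of_Ioo {f : ℝ → ℝ} {a b : ℝ} (hf : ConcaveOn ℝ (Ioo a b) f)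
    (hb : ∀ ε : ℝ, 0 < ε → ∀ᶠ y in 𝓝[<] b, f b ≤ f y + ε) : ConcaveOn ℝ (Ioc a b) f := by
  refine ⟨convex_Ioc a b, fun x hx y hy μ ν hμ hν hμν => ?_⟩
  simp only [smul_eq_mul]
  -- degenerate weights
  rcases hμ.eq_or_lt with hμ0 | hμ0
  · rw [← hμ0] at hμν ⊢; rw [zero_add] at hμν; rw [hμν]; simp
  rcases hν.eq_or_lt with hν0 | hν0
  · rw [← hν0] at hμν ⊢; rw [add_zero] at hμν; rw [hμν]; simp
  rcases hx.2.lt_or_eq with hxb | hxb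
  · rcases hy.2.lt_or_eq with hyb | hyb
    · have := hf.2 ⟨hx.1, hxb⟩ ⟨hy.1, hyb⟩ hμ hν hμν
      simpa only [smul_eq_mul] using this
    · rw [hyb]
      exact endpoint_right_aux hf ⟨hx.1, hxb⟩ hxb (fun w hw => ⟨lt_trans hx.1 hw.1, hw.2⟩) hb hμ0 hν0 hμν
  · rw [hxb]
    rcases hy.2.lt_or_eq with hyb | hyb
    · have := endpoint_right_aux hf ⟨hy.1, hyb⟩ hyb (fun w hw => ⟨lt_trans hy.1 hw.1, hw.2⟩) hb hν0 hμ0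
        (by linarith)
      rw [add_comm (μ * f b), add_comm (μ * b)]
      exact this
    · rw [hyb, ← add_mul, hμν, one_mul, ← add_mul, hμν, one_mul]

/-- **Adding the left endpoint.** If `f` is concave on `(a, b]` and `f a` does not exceed the lower limit of `f` at
`a⁺`, then `f` is concave on `[a, b]`. [ours; elementary] -/
theorem concaveOn_Icc_of_Ioc {f : ℝ → ℝ} {a b : ℝ} (hf : ConcaveOn ℝ (Ioc a b) f)
    (ha : ∀ ε : ℝ, 0 < ε → ∀ᶠ w in 𝓝[>] a, f a ≤ f w + ε) : ConcaveOn ℝ (Icc a b) f := by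
  refine ⟨convex_Icc a b, fun x hx y hy μ ν hμ hν hμν => ?_⟩
  simp only [smul_eq_mul]
  rcases hμ.eq_or_lt with hμ0 | hμ0
  · rw [← hμ0] at hμν ⊢; rw [zero_add] at hμν; rw [hμν]; simp
  rcases hν.eq_or_lt with hν0 | hν0
  · rw [← hν0] at hμν ⊢; rw [add_zero] at hμν; rw [hμν]; simp
  rcases hx.1.lt_or_eq with hax | hax
  · rcases hy.1.lt_or_eq with hay | hay
    · have := hf.2 ⟨hax, hx.2⟩ ⟨hay, hy.2⟩ hμ hν hμν
      simpa only [smul_eq_mul] using this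
    · -- y = a, x ∈ (a, b]
      rw [← hay]
      have := endpoint_left_aux hf ⟨hax, hx.2⟩ hax (fun w hw => ⟨hw.1, le_trans hw.2.le hx.2⟩) ha hν0 hμ0
        (by linarith)
      rw [add_comm (μ * f x), add_comm (μ * x)]
      exact this
  · rw [← hax]
    rcases hy.1.lt_or_eq with hay | hay
    · exact endpoint_left_aux hf ⟨hay, hy.2⟩ hay (fun w hw => ⟨hw.1, le_trans hw.2.le hy.2⟩) ha hμ0 hν0 hμν
    · rw [← hay, ← add_mul, hμν, one_mul, ← add_mul, hμν, one_mul]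

/-- **Closed interval from the open one, jumps DOWN allowed at both ends** (the form used at the sphere endpoints of a
line through Burkholder's domain): concave on `(a, b)` and each endpoint value not above the lower limit from inside
`⟹` concave on `[a, b]`. [ours; elementary] -/
theorem concaveOn_Icc_of_Ioo_of_liminf {f : ℝ → ℝ} {a b : ℝ} (hf : ConcaveOn ℝ (Ioo a b) f)
    (ha : ∀ ε : ℝ, 0 < ε → ∀ᶠ w in 𝓝[>] a, f a ≤ f w + ε)
    (hb : ∀ ε : ℝ, 0 < ε → ∀ᶠ y in 𝓝[<] b, f b ≤ f y + ε) : ConcaveOn ℝ (Icc a b) f :=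
  concaveOn_Icc_of_Ioc (concaveOn_Ioc_of_Ioo hf hb) ha

end Burk

end Summit.NavierStokesRegularity.FunctionalMining

end
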